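import Summits.BirchSwinnertonDyer.BirchSwinnertonDyer.Theorems.ByReductionTypeAtTwoSupersingularBlindPinchAntiInvariantsFinite
import Summits.BirchSwinnertonDyer.BirchSwinnertonDyer.Theorems.ByReductionTypeAtTwoSupersingularBlindPinchLocalKummerGrowth
import Summits.BirchSwinnertonDyer.BirchSwinnertonDyer.Theorems.ByReductionTypeAtTwoSupersingularBlindPinchTwistStrictRestriction
import Summits.BirchSwinnertonDyer.BirchSwinnertonDyer.Theorems.ThetaPartnerAtTwoSignedTransportAtTwoResidualKummer
import Literature.NumberTheory.EllipticCurves.Kato2004.IwasawaLayerQuadraticTwistH1Proofs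
import Literature.NumberTheory.EllipticCurves.QuadraticTwistSelmerPInfty
import Literature.NumberTheory.EllipticCurves.QuadraticTwist
import Literature.NumberTheory.EllipticCurves.Rank1Residual.Predicates
import Literature.NumberTheory.EllipticCurves.PAdicBSD
import HarnessLib

/-!
# Route `ByReductionTypeAtTwo` (rung K4), crux `SupersingularRankZeroAtTwo` (item stmt-BirchSwinnertonDyer-19097), hand hK87-C:
# **-imc's K87-C `BlindZeroOfTwistSelmerCorankAtTwo` IS A TREE THEOREM — `corank_{ℤ₂} Sel_{2^∞}(E^{(2)}/ℚ) ≥ 2 ⟹ (T+2) ∣ ξ^{col}`**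
# for every good-supersingular-at-2 `E/ℚ`, cyclotomic pins `(κ, γ)`, local datum `(v ∋ 2, g, c)`, chroma `col`, f.g. torsion
# •-dual datum `D` with `char X• = (ξ)` and every `ℚ`-model `W₂` of `E^{(2)}` (cell `bsd-2adic`, seat `bsd-2adic-t42` GEN 46;
# `--supports 19097`, helper)

HONEST FRAMING (D-0036/D-0054): THEOREMS ONLY (no definition, no named fact, no `sorry`, no instance). The conclusion of
`blindZeroOfTwistSelmerCorankAtTwo` is the body of -imc's candidate `Prop` K87-C (`Cruxes/SupersingularRankZeroAtTwo/
D87TwistPointPinchAtTwo.lean` §1, lines 111–123, tree sha16 `ee24b7858c2ca990`) VERBATIM — restated inline, no `Cruxes` import.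
HONEST LABEL: K87-C = research-free plumbing (`corank Sel(E^{(2)}) ≥ 2 ⟹ (T+2) ∣ ξ^{col}`); proved ⇒ census/CERT-class evidence on
stub 7's even half (`λ♭ = 1` rows of R-imc-76) via -imc's proved closer `bsdp_two_of_flatBlindPinch`; stub 7 NOT split, NOT closed;
no consumer use before REF1 R-87 PASS (director (839)); 19097 OPEN; nothing booked; BSD proved for no curve.

THE PROOF (contrapositive of -imc's mechanism (S1)–(S5)). Suppose `(T+2) ∤ ξ`.
(S5) `X•/(T+2)X•` is finite (`BlindPinch.finite_quotient_X_add_C_two_of_not_dvd`: `ℓ_{(T+2)}(X•) = 0`, an annihilator outside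
`(T+2)`). (S4) Hence the `conj_γ`-anti-invariants `A = Sel•(E/ℚ_∞) ∩ ker(conj_γ + 1)` are finite
(`BlindPinch.finite_antiInvariants_of_finite_quotient`: `D.toDual` restricted to `A` is onto `Hom(A, ℚ/ℤ)` and kills `(T+2)X•`).
(S2)(S3) The `v`-STRICT part `S′ = Sel_{2^∞}(E^{(2)}/ℚ) ∩ ker res_v` injects into `A` by `s ↦ Ψ(res_{ker κ} s)` — `Ψ` the twist
isomorphism along `√2 ∈ ℚ_∞` (tree `QuadraticTwistSelmer.twistH1Equiv`, `Kato2004.smul_geomSqrt_two_of_mem_layerSubgroup_one`),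
the image being Selmer over `ℚ_∞`, in the •-condition at every conjugate of the place over `v` by the torsion witness `(Q, k)` of a
strict class, anti-invariant since `γ√2 = −√2` (`κ γ = 1 ∉ 2ℤ₂`), injective since `E[2^∞]^{Gal(ℚ̄/ℚ_∞)} = 0` at good supersingular `2`
(`SignedTransportAtTwo.fixedPoints_kerSubgroup_eq_bot_of_goodSS`) — so `S′` is finite
(`BlindPinch.finite_strictSelmer_twist_of_finite_antiInvariants`). (S1) Then `corank_{ℤ₂} Sel_{2^∞}(E^{(2)}/ℚ) ≤ 1`
(`BlindPinch.selmerCorank_le_one_of_finite_strictAt`: `4^k ≤ #Sel[2^k] ≤ #S′ · [E^{(2)}(ℚ_v):U] · 2^k`, Silverman VII.6.3),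
and `Sel_{2^∞}(W₂/ℚ) ≅ Sel_{2^∞}(E^{(2)}/ℚ)` for every model `W₂` (`selmerCorank_eq_of_variableChange`) — contradicting `corank ≥ 2`.
No finiteness of `Ш(W₂)`, no Honda legality of `c`, no CM/rank/sign hypothesis, no control theorem; the binders
`[W.IsGloballyMinimal]` (through `GoodSS`) and `IsCyclotomicVariable 2 γ` are carried as typed (the latter idle).

References: [Sprung2012] Def. 7.9/7.11 (p. 1503), Thm. 7.14; [GreenbergLNM1716] §1 pp. 60, 65, §2 pp. 62–63, §3, §4 p. 107;
[SilvermanAEC2009] Prop. VII.6.3, X.2 Prop. 2.4, X.5 Cor. 5.4; [DokchitserDokchitserAnnals2010] Lemma 4.14 (proof);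
[Washington1997] §13.1–13.2.
-/

set_option autoImplicit false
-- the Theorems namespace of this sub repeats the summit name by design (D-0017 nested layout)
set_option linter.dupNamespace false

noncomputable section

open scoped Classical NumberField

namespace Summit.BirchSwinnertonDyer.BirchSwinnertonDyer.Theorems

namespace BlindPinch

open WeierstrassCurve Literature.NumberTheory.EllipticCurves Literature.NumberTheory.EllipticCurves.Sprung2012
  Literature.NumberTheory.EllipticCurves.Sprung2017 Literature.NumberTheory.GaloisRepresentations
  Literature.NumberTheory.EllipticCurves.QuadraticTwistSelmer Literature.NumberTheory.EllipticCurves.Rank1Residual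
  NumberField IsDedekindDomain ZpExtension PowerSeries

/-- `γ ∉ Gal(ℚ̄/ℚ₁)` for a topological generator `γ` (`κ γ = 1` is not divisible by `2` in `ℤ₂`). [cite: Washington1997, §13.1] -/
theorem not_mem_layerSubgroup_one_of_isTopGenerator {κ : ZpExtension ℚ 2} {γ : Field.absoluteGaloisGroup ℚ}
    (hγ : κ.IsTopGenerator γ) : γ ∉ κ.layerSubgroup 1 := by
  intro h
  rw [mem_layerSubgroup, pow_one] at h
  have h1 : (κ γ).toAdd = 1 := by rw [show κ γ = Multiplicative.ofAdd 1 from hγ, toAdd_ofAdd]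
  rw [h1] at h
  exact (PadicInt.prime_p (p := 2)).not_unit (isUnit_of_dvd_one h)

/-- **K87-C `BlindZeroOfTwistSelmerCorankAtTwo` (D-imc-87 §1, body VERBATIM): for `E/ℚ` good supersingular at `2`, cyclotomic
pins `(κ, γ)`, the place `v ∋ 2`, ANY local datum `(g, c)`, ANY chroma `col`, any finitely generated torsion •-dual datum `D` with
`char X• = (ξ)`, and any `ℚ`-model `W₂` of `E^{(2)}`: `corank_{ℤ₂} Sel_{2^∞}(W₂/ℚ) ≥ 2 ⟹ (T + 2) ∣ ξ`.** Proof: the module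
docstring ((S5)→(S4)→(S3)(S2)→(S1), by contradiction). [cite: Sprung2012, Def. 7.9/7.11 (p. 1503), Thm. 7.14]
[cite: GreenbergLNM1716, §3 and §4 p. 107 (restriction in the cyclotomic tower; `A_s = A` over `F_∞`)]
[cite: SilvermanAEC2009, Prop. VII.6.3] [cite: DokchitserDokchitserAnnals2010, Lemma 4.14] -/
theorem blindZeroOfTwistSelmerCorankAtTwo :
    ∀ (W : WeierstrassCurve ℚ) [W.IsElliptic] [W.IsGloballyMinimal], GoodSS W 2 →
    ∀ (κ : ZpExtension ℚ 2) (γ : Field.absoluteGaloisGroup ℚ),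
      κ.IsCyclotomic → κ.IsTopGenerator γ → IsCyclotomicVariable 2 γ →
    ∀ (v : HeightOneSpectrum (𝓞 ℚ)), (2 : 𝓞 ℚ) ∈ v.asIdeal →
    ∀ (g : Field.absoluteGaloisGroup (v.adicCompletion ℚ)) (c : ℕ → localPoints W (v.adicCompletion ℚ)) (col : Chroma)
      (D : SharpFlatSelmerDualData W κ γ (closureEmb (K := ℚ) (v.adicCompletion ℚ)) (W.frobeniusTrace 2) g c col)
      [Module.Finite (IwasawaAlgebra 2) D.X], Module.IsTorsion (IwasawaAlgebra 2) D.X →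
    ∀ (ξ : IwasawaAlgebra 2), D.charIdeal = Ideal.span {ξ} →
    ∀ (W₂ : WeierstrassCurve ℚ) [W₂.IsElliptic],
      (∃ C : WeierstrassCurve.VariableChange ℚ, C • W.quadraticTwist 2 = W₂) →
      2 ≤ W₂.selmerCorank 2 →
      (PowerSeries.X + PowerSeries.C (2 : ℤ_[2]) : IwasawaAlgebra 2) ∣ ξ := by
  intro W _ _ hss κ γ hκ hγ _ v hv g c col D _ hX ξ hξ W₂ _ hW₂ h2
  by_contra hndvd
  -- (S5) `X•/(T+2)X•` is finite
  haveI : Finite (D.X ⧸ (Ideal.span {(PowerSeries.X + PowerSeries.C (2 : ℤ_[2]) : IwasawaAlgebra 2)} •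
      (⊤ : Submodule (IwasawaAlgebra 2) D.X))) :=
    finite_quotient_X_add_C_two_of_not_dvd hX hξ hndvd
  -- (S4) the `conj_γ`-anti-invariants of `Sel•(E/ℚ_∞)` are finite
  have hA := finite_antiInvariants_of_finite_quotient D
  -- `√2 ∈ ℚ_∞`, `γ√2 = −√2`, `E[2^∞]^{Gal(ℚ̄/ℚ_∞)} = 0`
  obtain ⟨C₁, hC₁⟩ := W.exists_variableChange_quadraticTwist_one
  have hθ : WeierstrassCurve.geomSqrt (2 : ℚ) ^ 2 = algebraMap ℚ (AlgebraicClosure ℚ) 2 :=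
    WeierstrassCurve.geomSqrt_sq (2 : ℚ)
  have hker : ∀ σ : Field.absoluteGaloisGroup ℚ, σ ∈ κ.kerSubgroup →
      σ • WeierstrassCurve.geomSqrt (2 : ℚ) = WeierstrassCurve.geomSqrt (2 : ℚ) := fun σ hσ ↦
    Kato2004.smul_geomSqrt_two_of_mem_layerSubgroup_one κ hκ (κ.kerSubgroup_le_layerSubgroup 1 hσ)
  have hsign : quadraticSign (WeierstrassCurve.geomSqrt (2 : ℚ)) γ = -1 :=
    quadraticSign_of_smul_eq_neg (WeierstrassCurve.geomSqrt_ne_zero two_ne_zero)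
      (Kato2004.smul_geomSqrt_two_of_not_mem_layerSubgroup_one κ hκ (not_mem_layerSubgroup_one_of_isTopGenerator hγ))
  have hfix := SignedTransportAtTwo.fixedPoints_kerSubgroup_eq_bot_of_goodSS W hss κ
  -- (S2)(S3) the `v`-strict part of `Sel_{2^∞}(E^{(2)}/ℚ)` is finite
  haveI : (W.quadraticTwist 2).IsElliptic := W.isElliptic_quadraticTwist two_ne_zero
  have hS' : Finite ↥(selmerGroupPInfty (W.quadraticTwist 2) 2 ⊓
      (resPrimary (W.quadraticTwist 2) (v.adicCompletion ℚ) 2).ker) :=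
    finite_strictSelmer_twist_of_finite_antiInvariants W hC₁ two_ne_zero hθ 2 κ hker (v.adicCompletion ℚ)
      (W.frobeniusTrace 2) g c col hsign hfix hA
  -- (S1) `corank Sel_{2^∞}(E^{(2)}/ℚ) ≤ 1`
  have hv' : ((2 : ℕ) : 𝓞 ℚ) ∈ v.asIdeal := by rw [Nat.cast_ofNat]; exact hv
  have hle := selmerCorank_le_one_of_finite_strictAt 2 (W.quadraticTwist 2) v hv' hS'
  -- `W₂ ≅ E^{(2)}` over `ℚ`
  obtain ⟨C, hC⟩ := hW₂
  have hcor : (W.quadraticTwist 2).selmerCorank 2 = W₂.selmerCorank 2 := selmerCorank_eq_of_variableChange 2 hC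
  omega

end BlindPinch

end Summit.BirchSwinnertonDyer.BirchSwinnertonDyer.Theorems

end
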